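import Summits.QuantumAdvantage.QuantumAdvantage.Theorems.CubicForrelationNearExactIsExactEightLevelFour
import Summits.QuantumAdvantage.QuantumAdvantage.Theorems.CubicForrelationNearExactIsExactRothausB

/-!
# Crux `CubicForrelation.NearExactIsExact` (stmt-QuantumAdvantage-14043) — MINIMUM-WEIGHT words of a Reed–Muller code are FLATS

Certificate seat `b2b-cforr-cert` (gen 4).  HONEST FRAMING: a classical coding-theory lemma stated for Boolean functions of bounded algebraic
degree (input to the two-sided boundary analyses of the finite slices `n = 14, 16, 18` of the crux) — NOT summit progress.

`mw_flat_of_minweight`: if `e : 𝔽₂^m → 𝔽₂` has algebraic degree `≤ d + 1` and EXACTLY `2^{m−d−1}` ones (stated as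
`2^{d+1}·#{e = 1} = 2^m`, the minimum weight of `RM(d+1, m)`), then its set of periods `V₀ = {a : e(x ⊕ a) = e(x) ∀ x}` is `⊕`-closed with
`#V₀ = #{e = 1}` and the ones of `e` form ONE coset `x₀ ⊕ V₀` — a flat of dimension `m − d − 1`.  Proof (elementary double counting, the
landed `el_flat_of_quadratic` / `qf_flat_of_quadratic` are the instances `d = 1`, `m = 8, 14`): every derivative `e ⊕ e(· ⊕ a)` has
degree `≤ d` (`stub_derivDegree`), so by the Reed–Muller bound (`bb_rmWeight_holds`) it is `0` or has `≥ 2^{m−d} = 2·#{e=1}` ones, while it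
has at most `#{e=1} + #{e=1}` ones; hence each `a` is a period or moves the support off itself, and `Σ_a #{e ≠ e(·⊕a)} = 2·#{e=1}·#{e=0}`
counts exactly `#{e = 0}` non-periods.

References: F. J. MacWilliams, N. J. A. Sloane, *The Theory of Error-Correcting Codes* (1977), Ch. 13 §4 (minimum-weight codewords of
`RM(r,m)` are incidence vectors of `(m−r)`-flats); C. Carlet, *Boolean Functions for Cryptography and Coding Theory*, CUP 2021, §4.1.
Everything below is proved from Mathlib and the tree; axioms are the standard three.
-/

set_option linter.dupNamespace false -- D-0017: single-problem summit ⇒ `QuantumAdvantage.QuantumAdvantage` by design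

noncomputable section

namespace Summit.QuantumAdvantage.QuantumAdvantage.Theorems.CubicForrelation.NearExactIsExact

open Finset
open Literature.Computability.QuantumComplexity
open Literature.Computability.QuantumComplexity.BuzetChailloux (bxor zeroVec bxor_bxor_cancel_left bxor_zeroVec zeroVec_bxor)

variable {m : ℕ}

/-- **Minimum-weight words of `RM(d+1,m)` are flats.** If `e : 𝔽₂^m → 𝔽₂` has degree `≤ d + 1` and `2^{d+1}·#{e = 1} = 2^m`, then the
periods `V₀ = {a : ∀ x, e(x ⊕ a) = e(x)}` contain `0`, are `⊕`-closed, `#V₀ = #{e = 1}`, and `{e = 1} = x₀ ⊕ V₀` for every `x₀` with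
`e(x₀) = 1`. [cite: MacWilliamsSloane1977, Ch. 13 §4] -/
theorem mw_flat_of_minweight (d : ℕ) (e : (Fin m → Bool) → Bool) (he : IsDegLeFun (d + 1) e)
    (hS : 2 ^ (d + 1) * #(univ.filter fun x => e x = true) = 2 ^ m) :
    zeroVec ∈ (univ.filter fun a : Fin m → Bool => ∀ x, e (bxor x a) = e x) ∧
    (∀ a ∈ (univ.filter fun a : Fin m → Bool => ∀ x, e (bxor x a) = e x),
      ∀ b ∈ (univ.filter fun a : Fin m → Bool => ∀ x, e (bxor x a) = e x),
        bxor a b ∈ (univ.filter fun a : Fin m → Bool => ∀ x, e (bxor x a) = e x)) ∧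
    #(univ.filter fun a : Fin m → Bool => ∀ x, e (bxor x a) = e x) = #(univ.filter fun x => e x = true) ∧
    ∀ x₀, e x₀ = true → (univ.filter fun x => e x = true) =
      (univ.filter fun a : Fin m → Bool => ∀ x, e (bxor x a) = e x).image (bxor x₀) := by
  classical
  set V₀ := univ.filter (fun a : Fin m → Bool => ∀ x, e (bxor x a) = e x) with hV₀
  set S := univ.filter (fun x => e x = true) with hSdef
  have hM : #(univ : Finset (Fin m → Bool)) = 2 ^ m := by
    rw [card_univ, Fintype.card_fun, Fintype.card_bool, Fintype.card_fin]
  have hSle : #S ≤ 2 ^ m := by rw [← hM]; exact card_le_univ _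
  have hSpos : 0 < #S := by
    by_contra h0
    push Not at h0
    have : #S = 0 := by omega
    rw [this, mul_zero] at hS
    exact absurd hS.symm (pow_ne_zero _ two_ne_zero)
  have h0 : zeroVec ∈ V₀ := mem_filter.2 ⟨mem_univ _, fun x => by rw [bxor_zeroVec]⟩
  have hadd : ∀ a ∈ V₀, ∀ b ∈ V₀, bxor a b ∈ V₀ := by
    intro a ha b hb
    refine mem_filter.2 ⟨mem_univ _, fun x => ?_⟩
    rw [← iw_bxor_assoc, (mem_filter.1 hb).2, (mem_filter.1 ha).2]
  -- weight of a derivative: `0` or `2·#S`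
  have hD : ∀ a, #(univ.filter fun x => (e x ^^ e (bxor x a)) = true) = 0 ∨
      #(univ.filter fun x => (e x ^^ e (bxor x a)) = true) = 2 * #S := by
    intro a
    have hdeg : IsDegLeFun d (fun x => e x ^^ e (bxor x a)) := stub_derivDegree m d e a he
    have hle : #(univ.filter fun x => (e x ^^ e (bxor x a)) = true) ≤ 2 * #S := by
      calc #(univ.filter fun x => (e x ^^ e (bxor x a)) = true)
          ≤ #((univ.filter fun x => e x = true) ∪ univ.filter fun x => e (bxor x a) = true) := by
            refine card_le_card fun x hx => ?_
            have h' := (mem_filter.1 hx).2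
            rw [mem_union, mem_filter, mem_filter]
            revert h'; cases e x <;> cases e (bxor x a) <;> simp
        _ ≤ #(univ.filter fun x => e x = true) + #(univ.filter fun x => e (bxor x a) = true) := card_union_le _ _
        _ = #S + #S := by
            congr 1
            refine card_nbij' (fun x => bxor x a) (fun x => bxor x a) (fun x hx => ?_) (fun x hx => ?_)
              (fun x _ => by show bxor (bxor x a) a = x; rw [iw_bxor_assoc, BuzetChailloux.bxor_self, bxor_zeroVec])
              (fun x _ => by show bxor (bxor x a) a = x; rw [iw_bxor_assoc, BuzetChailloux.bxor_self, bxor_zeroVec])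
            · exact mem_filter.2 ⟨mem_univ _, (mem_filter.1 hx).2⟩
            · refine mem_filter.2 ⟨mem_univ _, ?_⟩
              rw [iw_bxor_assoc, BuzetChailloux.bxor_self, bxor_zeroVec]; exact (mem_filter.1 hx).2
        _ = 2 * #S := by ring
    by_cases hz : #(univ.filter fun x => (e x ^^ e (bxor x a)) = true) = 0
    · exact Or.inl hz
    · right
      obtain ⟨x, hx⟩ : ∃ x, (e x ^^ e (bxor x a)) = true := by
        by_contra hno
        push Not at hno
        exact hz (card_eq_zero.2 (filter_eq_empty_iff.2 fun x _ => hno x))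
      have hRM := bb_rmWeight_holds m d _ hdeg ⟨x, hx⟩
      -- 2^m = 2^d · (2 · #S)
      have h2 : 2 ^ m = 2 ^ d * (2 * #S) := by rw [← hS, pow_succ]; ring
      rw [h2] at hRM
      have := Nat.le_of_mul_le_mul_left hRM (by positivity)
      omega
  have hmemV : ∀ a, a ∈ V₀ ↔ #(univ.filter fun x => (e x ^^ e (bxor x a)) = true) = 0 := by
    intro a
    rw [card_eq_zero, filter_eq_empty_iff]
    constructor
    · intro ha x _; rw [(mem_filter.1 ha).2 x, Bool.xor_self]; exact Bool.false_ne_true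
    · intro h0'; refine mem_filter.2 ⟨mem_univ _, fun x => ?_⟩
      have := h0' (mem_univ x); revert this; cases e x <;> cases e (bxor x a) <;> simp
  -- the complement count
  have hSc : #(univ.filter fun x : Fin m → Bool => ¬ e x = true) = 2 ^ m - #S := by
    have h := card_filter_add_card_filter_not (s := (univ : Finset (Fin m → Bool))) (fun x => e x = true)
    rw [hM] at h
    have h' : #S + #(univ.filter fun x : Fin m → Bool => ¬ e x = true) = 2 ^ m := h
    omega
  -- double counting
  have hcount : ∑ a, (#(univ.filter fun x => (e x ^^ e (bxor x a)) = true) : ℕ) = 2 * #S * (2 ^ m - #S) := by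
    simp_rw [card_filter]
    rw [sum_comm]
    have inner : ∀ x, ∑ a, (if (e x ^^ e (bxor x a)) = true then 1 else 0 : ℕ) =
        if e x = true then 2 ^ m - #S else #S := by
      intro x
      rw [Fintype.sum_equiv (Equiv.mk (bxor x) (bxor x) (bxor_bxor_cancel_left x) (bxor_bxor_cancel_left x))
        (fun a => if (e x ^^ e (bxor x a)) = true then 1 else 0) (fun y => if (e x ^^ e y) = true then 1 else 0) (fun _ => rfl)]
      rw [sum_boole]
      cases hx : e x
      · simp only [Bool.false_xor, Bool.false_eq_true, if_false, Nat.cast_id]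
        rfl
      · simp only [Bool.true_xor, if_true, Bool.not_eq_true', Nat.cast_id]
        have hc' : (univ.filter fun y : Fin m → Bool => ¬ e y = true) = univ.filter fun y => e y = false :=
          filter_congr fun y _ => by cases e y <;> simp
        rw [← hc']; exact hSc
    rw [sum_congr rfl fun x _ => inner x, sum_ite, sum_const, sum_const, smul_eq_mul, smul_eq_mul]
    rw [show (univ.filter fun x : Fin m → Bool => e x = true) = S from rfl, hSc]
    ring
  have hcount' : ∑ a, (#(univ.filter fun x => (e x ^^ e (bxor x a)) = true) : ℕ) = 2 * #S * #(univ.filter fun a => a ∉ V₀) := by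
    rw [← sum_filter_add_sum_filter_not univ (fun a => a ∈ V₀)]
    rw [sum_eq_zero fun a ha => (hmemV a).1 (mem_filter.1 ha).2, zero_add]
    rw [sum_congr rfl fun a ha => ((hD a).resolve_left fun h => absurd ((hmemV a).2 h) (mem_filter.1 ha).2), sum_const,
      smul_eq_mul, mul_comm]
  have hcardV : #V₀ = #S := by
    have h1 : #(univ.filter fun a : Fin m → Bool => a ∉ V₀) = 2 ^ m - #S := by
      have h := hcount.symm.trans hcount'
      have h2S : 0 < 2 * #S := by omega
      exact (Nat.eq_of_mul_eq_mul_left h2S h).symm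
    have h2 := card_filter_add_card_filter_not (s := (univ : Finset (Fin m → Bool))) (fun a => a ∈ V₀)
    rw [h1, filter_mem_eq_inter, univ_inter, hM] at h2
    omega
  refine ⟨h0, hadd, hcardV, fun x₀ hx₀ => ?_⟩
  symm
  apply eq_of_subset_of_card_le
  · intro y hy
    obtain ⟨a, ha, rfl⟩ := mem_image.1 hy
    exact mem_filter.2 ⟨mem_univ _, by rw [(mem_filter.1 ha).2 x₀]; exact hx₀⟩
  · rw [card_image_of_injective _ fun a b hab => by simpa only [bxor_bxor_cancel_left] using congrArg (bxor x₀) hab, hcardV]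

end Summit.QuantumAdvantage.QuantumAdvantage.Theorems.CubicForrelation.NearExactIsExact

end
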